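import Summits.QuantumFields.BalabanUV.Gaps.D1RecordWardPinsBorderWeight

/-!
# `BalabanUV.Gaps.D1RecordUnitBorderUniversal` — cell pub-balaban-gaps, row (D1), seat g1-p1: THE UNIT BORDER TOWER OF leaf-05's SLOTTED FAMILY IS FREE OF THE FIRST-ORDER SLOTS AND OF THE
# WILSON TABLE — so for the b2b wall's (III′) literal it is ONE kernel per (Lc, table record, level), FREE OF THE NUMERAL `N` AND OF `cΛ`; the Ward-pin equation of
# `Gaps/D1RecordWardPinsBorderWeight` has a UNIVERSAL slope

HONEST FRAMING (cell rule, page 1 of everything): [folklore] kernel algebra BY NAME — GEN 15's `D1RecordWardPinsBorderWeight` (`T2RecOf_border_affine`, `WrecOf_sub`, `TbalOf_JsB12CombShSym_border_affine`),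
leaf-05's `RecursiveWSlot`, gan24's `e4OfKW_add_carrier` ∕ `vsym_smul`, GEN 12's `vsym_sub` ∕ `loc_vsym` ∕ `hessKer_sub_W`, an2's `CombChartStepJets` ∕ `TbalOf_JsB12CombShSym`.  Nothing of Bałaban's
asserted; NO coefficient computed or signed; (D1) NOT discharged; 0∕4 row-D1 binders; NOT `BetaPertH`, NOT continuum, NOT Clay.

CONTENT (all [folklore]; no `def`, 0 sorry): **`T2RecOf_unitBorder_universal`** (for two slot systems `(S, M, T)` and `(S′, M′, T′)` over the SAME propagators `G`, weight `cE₂` and binder tables: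
`T2RecOf G S M cE₂ 1 T … j − T2RecOf G S M cE₂ 0 T … j = T2RecOf G S′ M′ cE₂ 1 T′ … j − T2RecOf G S′ M′ cE₂ 0 T′ … j` — the unit border tower obeys a recursion free of the slots:
`U₀ = vh₂S`, `U_{j+1} = (cE₂·wV4)•(−mmRead(G_j ∘ vsym G_j Lc U_j ∘ G_j)) + wB2•vh₂S`), **`record_unitBorder_universal`** (the (III′) literal's unit border kernel `T_j(N, cΛ; 1) − T_j(N, cΛ; 0)` is
the SAME for every numeral `N` and every `cΛ`, entrywise), `record_unitBorder_zerothMoment_universal`, **`record_borderWeight_unique_of_ward_universal`** (if the universal unit-border zeroth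
moment is nonzero in some channel at level `j`, then FOR EVERY `N` and `cΛ` at most one border weight admits `hW` at level `j`).

Provenance: cell pub-balaban-gaps, seat g1-p1 GEN 15 (prover-pub-balaban-gaps-g1-p1-g15-0), 2026-08-25; imports GEN 15's `Gaps/D1RecordWardPinsBorderWeight`; no existing file touched.
-/

noncomputable section

open Literature.MathematicalPhysics.QuantumFieldTheory Balaban1983to89 Balaban1983to89.Beta Filter Topology
open ExpKernelCalculus (MKer Decays VertexFamily VertexFamily₂ hessKer tadpole comp)
open BalabanStepJetsSucc (mmRead)
open OneStepResolventKernel (Fib LocStencil JetData)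
open OneStepKernelFamily (TbalOf flipK)
open PolarizationSign (WardTransversal MomentSummable)
open OddMoments (zerothMoment)
open BalabanCompositeJets (LocStencil₂)
open SecondOrderResponse (LocStencilFM)
open BalabanStepW2 (M2Of wV4 wB2 locStencil₂_smul' locStencil₂_add')
open Summit.QuantumFields.BalabanUV.Beta.TameKernelCalculus (Spr Loc)
open Summit.QuantumFields.BalabanUV.Beta.SpineRooted (e4OfKW T2RecOf WrecOf T2RecOf_zero_level T2RecOf_succ WrecOf_eq T2RecOf_loc vertexFamily₂_WrecOf')
open Summit.QuantumFields.BalabanUV.Beta.GAN24.T2RecursionAffine (vsym W2SymOfK_eq_add_vsym)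
open Summit.QuantumFields.BalabanUV.Beta.GAN24.Lin4Additive (vsym_smul)
open Summit.QuantumFields.BalabanUV.Beta.GAN24.ThirdJetKernel (mmRead_smul)
open Summit.QuantumFields.BalabanUV.Beta.GAN24.EvenTowerAutonomy (e4OfKW_add_carrier)
open Summit.QuantumFields.BalabanUV.Beta.SymmetrisedStepJets (SymTables)
open Summit.QuantumFields.BalabanUV.Beta.CombChartStepJets (GcombSh decays_GcombSh SpureCombOf WcombOf WcombOf_eq locStencil_SpureCombOf vertexFamily₂_WcombOf JsB12CombSh0
  JsB12CombSh0_eq JsComb0Of_S JsComb0Of_W)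
open Summit.QuantumFields.BalabanUV.Beta.CombChartJointEnd (JsB12CombShSym TbalOf_JsB12CombShSym)
open Summit.QuantumFields.BalabanUV.Gaps.D1PinnedResponseTowers (hessKer_sub_W)
open Summit.QuantumFields.BalabanUV.Gaps.D1PinnedColourRayQuartic (loc_vsym)
open Summit.QuantumFields.BalabanUV.Gaps.D1RecordWardPinsBorderWeight (WrecOf_sub T2RecOf_border_affine record_borderWeight_eq_of_ward)
open Summit.QuantumFields.BalabanUV.Gaps.D1WardPinsBorderWeight (eq_zero_of_affine_pair)

namespace Summit.QuantumFields.BalabanUV.Gaps.D1RecordUnitBorderUniversal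

/-! ## §1 The unit border tower of the slotted family does not see the first-order slots or the Wilson table -/

section Slots

variable {d Lc : ℕ} [NeZero Lc]
variable {G : ℕ → MKer (d + 1) (Fib d)} (cE₂ : ℝ) {vh₂S mixFF : Fin (d + 1) → (Fin (d + 1) → ℤ) → Fin (d + 1) → (Fin (d + 1) → ℤ) → MKer (d + 1) (Fib d)}

/-- [folklore] THE STEP OF THE UNIT BORDER TOWER (any slots): `U_{j+1} b = (cE₂·wV4 (j+1)) • (−mmRead Lc (G_j ∘ vsym G_j Lc U_j b ∘ G_j)) + wB2 (j+1) • vh₂S b`, `U_j := T2RecOf … 1 … j − T2RecOf … 0 … j`. -/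
theorem unitBorder_succ {S M : ℕ → Fin (d + 1) → (Fin (d + 1) → ℤ) → MKer (d + 1) (Fib d)} (T : Fin 4 → Fin 4 → Fin 4 → Fin 4 → ℝ)
    (hLc : 1 ≤ Lc) (hG : ∀ j : ℕ, ∃ δ C : ℝ, 0 < δ ∧ 0 ≤ C ∧ Decays (G j) C δ)
    (hS : ∀ j : ℕ, ∃ Cs δ : ℝ, 0 < δ ∧ LocStencil (S j) Cs δ) (hM : ∀ j : ℕ, ∃ CM δ : ℝ, 0 < δ ∧ VertexFamily (M j) Lc CM δ)
    (hB : ∃ C δ : ℝ, 0 < δ ∧ LocStencil₂ vh₂S C δ) (hmix : ∃ C δ : ℝ, 0 < δ ∧ LocStencilFM Lc mixFF C δ) (j : ℕ)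
    (κ : Fin (d + 1)) (u : Fin (d + 1) → ℤ) (κ' : Fin (d + 1)) (u' : Fin (d + 1) → ℤ) :
    T2RecOf d Lc G S M cE₂ 1 T vh₂S mixFF (j + 1) κ u κ' u' - T2RecOf d Lc G S M cE₂ 0 T vh₂S mixFF (j + 1) κ u κ' u' =
      (cE₂ * wV4 d Lc (j + 1)) • (-mmRead Lc (comp (comp (G j) (vsym (G j) Lc
          (T2RecOf d Lc G S M cE₂ 1 T vh₂S mixFF j - T2RecOf d Lc G S M cE₂ 0 T vh₂S mixFF j) κ u κ' u')) (G j))) + wB2 d Lc (j + 1) • vh₂S κ u κ' u' := by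
  -- `Loc` data
  obtain ⟨δK, CK, hδK, -, hK⟩ := hG j
  have hGs : Spr (G j) := ⟨CK, δK, hδK, hK⟩
  obtain ⟨Cw, δw, hδw, hWl⟩ := vertexFamily₂_WrecOf' cE₂ (0 : ℝ) T vh₂S mixFF hLc hG hS hM hB hmix j
  have hU : ∃ C δ : ℝ, 0 < δ ∧ LocStencil₂ (T2RecOf d Lc G S M cE₂ 1 T vh₂S mixFF j - T2RecOf d Lc G S M cE₂ 0 T vh₂S mixFF j) C δ := by
    obtain ⟨C₁, δ₁, hδ₁, h₁⟩ := T2RecOf_loc cE₂ (1 : ℝ) T vh₂S mixFF hLc hG hS hM hB hmix j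
    obtain ⟨C₀, δ₀, hδ₀, h₀⟩ := T2RecOf_loc cE₂ (0 : ℝ) T vh₂S mixFF hLc hG hS hM hB hmix j
    have h := locStencil₂_add' (h₁.mono (min_le_left δ₁ δ₀)) (locStencil₂_smul' (-1 : ℝ) (h₀.mono (min_le_right δ₁ δ₀)))
    have e : (T2RecOf d Lc G S M cE₂ 1 T vh₂S mixFF j - T2RecOf d Lc G S M cE₂ 0 T vh₂S mixFF j) =
        fun κ u κ' u' => T2RecOf d Lc G S M cE₂ 1 T vh₂S mixFF j κ u κ' u' + (-1 : ℝ) • T2RecOf d Lc G S M cE₂ 0 T vh₂S mixFF j κ u κ' u' := by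
      funext κ u κ' u'; simp only [Pi.sub_apply, neg_one_smul, sub_eq_add_neg]
    rw [e]; exact ⟨_, _, lt_min hδ₁ hδ₀, h⟩
  have hW1 : WrecOf d Lc G S M cE₂ 1 T vh₂S mixFF j = WrecOf d Lc G S M cE₂ 0 T vh₂S mixFF j +
      (fun κ u κ' u' => vsym (G j) Lc (T2RecOf d Lc G S M cE₂ 1 T vh₂S mixFF j - T2RecOf d Lc G S M cE₂ 0 T vh₂S mixFF j) κ u κ' u') := by
    funext κ u κ' u'
    have h := WrecOf_sub cE₂ T hLc hG hS hM hB hmix 1 0 j κ u κ' u'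
    simp only [Pi.add_apply]
    rw [← h]; abel
  have hLW : Loc (WrecOf d Lc G S M cE₂ 0 T vh₂S mixFF j κ u κ' u') := ⟨_, _, _, _, hδw, hWl κ u κ' u'⟩
  have hLX : Loc ((fun κ u κ' u' => vsym (G j) Lc (T2RecOf d Lc G S M cE₂ 1 T vh₂S mixFF j - T2RecOf d Lc G S M cE₂ 0 T vh₂S mixFF j) κ u κ' u') κ u κ' u') :=
    loc_vsym (hG j) _ hU κ u κ' u'
  simp only [T2RecOf_succ]
  rw [hW1, e4OfKW_add_carrier Lc hGs (S j) (M j) κ u κ' u' hLW hLX]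
  funext x z a b
  simp only [Pi.add_apply, Pi.sub_apply, Pi.smul_apply, Pi.neg_apply, smul_eq_mul, one_mul, zero_mul]
  ring

/-- [folklore] **THE UNIT BORDER TOWER IS FREE OF THE FIRST-ORDER SLOTS AND OF THE WILSON TABLE**: for two slot systems `(S, M, T)`, `(S′, M′, T′)` over the same `G`, `cE₂`, `vh₂S`, `mixFF`
(all certified), `T2RecOf G S M cE₂ 1 T … j − T2RecOf G S M cE₂ 0 T … j = T2RecOf G S′ M′ cE₂ 1 T′ … j − T2RecOf G S′ M′ cE₂ 0 T′ … j` at every level (induction on `unitBorder_succ`). -/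
theorem T2RecOf_unitBorder_universal {S M S' M' : ℕ → Fin (d + 1) → (Fin (d + 1) → ℤ) → MKer (d + 1) (Fib d)} (T T' : Fin 4 → Fin 4 → Fin 4 → Fin 4 → ℝ)
    (hLc : 1 ≤ Lc) (hG : ∀ j : ℕ, ∃ δ C : ℝ, 0 < δ ∧ 0 ≤ C ∧ Decays (G j) C δ)
    (hS : ∀ j : ℕ, ∃ Cs δ : ℝ, 0 < δ ∧ LocStencil (S j) Cs δ) (hM : ∀ j : ℕ, ∃ CM δ : ℝ, 0 < δ ∧ VertexFamily (M j) Lc CM δ)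
    (hS' : ∀ j : ℕ, ∃ Cs δ : ℝ, 0 < δ ∧ LocStencil (S' j) Cs δ) (hM' : ∀ j : ℕ, ∃ CM δ : ℝ, 0 < δ ∧ VertexFamily (M' j) Lc CM δ)
    (hB : ∃ C δ : ℝ, 0 < δ ∧ LocStencil₂ vh₂S C δ) (hmix : ∃ C δ : ℝ, 0 < δ ∧ LocStencilFM Lc mixFF C δ) :
    ∀ j : ℕ, T2RecOf d Lc G S M cE₂ 1 T vh₂S mixFF j - T2RecOf d Lc G S M cE₂ 0 T vh₂S mixFF j =
      T2RecOf d Lc G S' M' cE₂ 1 T' vh₂S mixFF j - T2RecOf d Lc G S' M' cE₂ 0 T' vh₂S mixFF j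
  | 0 => by
    funext κ u κ' u'
    simp only [T2RecOf_zero_level, Pi.sub_apply]
    funext x z a b
    simp only [Pi.add_apply, Pi.sub_apply, Pi.smul_apply, smul_eq_mul]
    ring
  | j + 1 => by
    have IH := T2RecOf_unitBorder_universal T T' hLc hG hS hM hS' hM' hB hmix j
    funext κ u κ' u'
    simp only [Pi.sub_apply]
    rw [unitBorder_succ cE₂ T hLc hG hS hM hB hmix j κ u κ' u', unitBorder_succ cE₂ T' hLc hG hS' hM' hB hmix j κ u κ' u', IH]

end Slots

/-! ## §2 The (III′) literal: the unit border kernel is free of the numeral and of `cΛ` -/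

section Record

variable {Lc : ℕ} [NeZero Lc]

/-- [folklore] **THE RECORD FAMILY's UNIT BORDER KERNEL IS THE SAME FOR EVERY NUMERAL `N` AND EVERY `cΛ`** (same table record, level, entry): `T_j(N,cΛ;1) − T_j(N,cΛ;0) = T_j(N′,cΛ′;1) − T_j(N′,cΛ′;0)`
— both equal `½·tadpole (G′_j) (vsym G′_j Lc U_j (μ,0;ν,·))` with the slot-free `U_j` of §1 (`hessKer_sub_W`, `WrecOf_sub`, `T2RecOf_unitBorder_universal`). -/
theorem record_unitBorder_universal (hLc : Odd Lc) (N N' : ℕ) (tabs : SymTables 3 Lc) (cΛ cΛ' : ℝ) (j : ℕ) (μ ν : Fin 4) (z : Fin 4 → ℤ) :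
    TbalOf Lc (JsB12CombShSym hLc N tabs cΛ 1) j μ ν z - TbalOf Lc (JsB12CombShSym hLc N tabs cΛ 0) j μ ν z =
      TbalOf Lc (JsB12CombShSym hLc N' tabs cΛ' 1) j μ ν z - TbalOf Lc (JsB12CombShSym hLc N' tabs cΛ' 0) j μ ν z := by
  have h1 : (1 : ℕ) ≤ Lc := Nat.one_le_iff_ne_zero.mpr (NeZero.ne Lc)
  obtain ⟨δK, CK, hδK, -, hK⟩ := decays_GcombSh (d := 3) Lc j
  have hGs : Spr (GcombSh (d := 3) Lc j) := ⟨CK, δK, hδK, hK⟩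
  have hLoc : ∀ (Nn : ℕ) (cl cB'' : ℝ), Loc ((JsB12CombSh0 hLc Nn tabs cl cB'' j).W μ 0 ν z) := fun Nn cl cB'' => by
    obtain ⟨Cw, δw, hδw, hW⟩ := vertexFamily₂_WcombOf tabs ((Lc : ℝ) ^ 4) (-((Lc : ℝ) ^ 8 / 2)) cl ((Lc : ℝ) ^ 8) cB'' ((8 * (Nn : ℝ) ^ 2)⁻¹ • WilsonVertex2Sym.wsym22 Nn) j
    rw [JsB12CombSh0_eq, JsComb0Of_W]
    exact ⟨_, _, _, _, hδw, hW μ 0 ν z⟩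
  have hS : ∀ (Nn : ℕ) (cl cB'' : ℝ), (JsB12CombSh0 hLc Nn tabs cl cB'' j).S = (JsB12CombSh0 hLc Nn tabs cl 0 j).S := fun Nn cl cB'' => by
    rw [JsB12CombSh0_eq, JsB12CombSh0_eq, JsComb0Of_S, JsComb0Of_S]
  have hd : ∀ (Nn : ℕ) (cl : ℝ), TbalOf Lc (JsB12CombShSym hLc Nn tabs cl 1) j μ ν z - TbalOf Lc (JsB12CombShSym hLc Nn tabs cl 0) j μ ν z =
      (1 / 2) * tadpole (GcombSh (d := 3) Lc j) ((JsB12CombSh0 hLc Nn tabs cl 1 j).W μ 0 ν z - (JsB12CombSh0 hLc Nn tabs cl 0 j).W μ 0 ν z) := fun Nn cl => by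
    rw [TbalOf_JsB12CombShSym, TbalOf_JsB12CombShSym, hS Nn cl 1]
    exact hessKer_sub_W hGs _ μ ν z (hLoc Nn cl 1) (hLoc Nn cl 0)
  have hWd : ∀ (Nn : ℕ) (cl : ℝ), (JsB12CombSh0 hLc Nn tabs cl 1 j).W μ 0 ν z - (JsB12CombSh0 hLc Nn tabs cl 0 j).W μ 0 ν z =
      vsym (GcombSh (d := 3) Lc j) Lc (T2RecOf 3 Lc (GcombSh Lc) (SpureCombOf tabs ((Lc : ℝ) ^ 4) (-((Lc : ℝ) ^ 8 / 2)) cl) tabs.M ((Lc : ℝ) ^ 8) 1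
          ((8 * (Nn : ℝ) ^ 2)⁻¹ • WilsonVertex2Sym.wsym22 Nn) tabs.vh₂S tabs.mixFF j -
        T2RecOf 3 Lc (GcombSh Lc) (SpureCombOf tabs ((Lc : ℝ) ^ 4) (-((Lc : ℝ) ^ 8 / 2)) cl) tabs.M ((Lc : ℝ) ^ 8) 0
          ((8 * (Nn : ℝ) ^ 2)⁻¹ • WilsonVertex2Sym.wsym22 Nn) tabs.vh₂S tabs.mixFF j) μ 0 ν z := fun Nn cl => by
    simp only [JsB12CombSh0_eq, JsComb0Of_W, WcombOf_eq]
    exact WrecOf_sub ((Lc : ℝ) ^ 8) ((8 * (Nn : ℝ) ^ 2)⁻¹ • WilsonVertex2Sym.wsym22 Nn) h1 (decays_GcombSh (d := 3) Lc)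
      (locStencil_SpureCombOf tabs ((Lc : ℝ) ^ 4) (-((Lc : ℝ) ^ 8 / 2)) cl) tabs.hM tabs.hB tabs.hmix 1 0 j μ 0 ν z
  rw [hd N cΛ, hd N' cΛ', hWd N cΛ, hWd N' cΛ',
    T2RecOf_unitBorder_universal ((Lc : ℝ) ^ 8) ((8 * (N : ℝ) ^ 2)⁻¹ • WilsonVertex2Sym.wsym22 N) ((8 * (N' : ℝ) ^ 2)⁻¹ • WilsonVertex2Sym.wsym22 N') h1
      (decays_GcombSh (d := 3) Lc) (locStencil_SpureCombOf tabs ((Lc : ℝ) ^ 4) (-((Lc : ℝ) ^ 8 / 2)) cΛ) tabs.hM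
      (locStencil_SpureCombOf tabs ((Lc : ℝ) ^ 4) (-((Lc : ℝ) ^ 8 / 2)) cΛ') tabs.hM tabs.hB tabs.hmix j]

/-- [folklore] Hence the record family's unit-border ZEROTH MOMENTS are universal (same for every `N`, `cΛ`). -/
theorem record_unitBorder_zerothMoment_universal (hLc : Odd Lc) (N N' : ℕ) (tabs : SymTables 3 Lc) (cΛ cΛ' : ℝ) (j : ℕ) (c e : Fin 4) :
    zerothMoment (fun a b w => flipK (TbalOf Lc (JsB12CombShSym hLc N tabs cΛ 1) j) a b w - flipK (TbalOf Lc (JsB12CombShSym hLc N tabs cΛ 0) j) a b w) c e =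
      zerothMoment (fun a b w => flipK (TbalOf Lc (JsB12CombShSym hLc N' tabs cΛ' 1) j) a b w - flipK (TbalOf Lc (JsB12CombShSym hLc N' tabs cΛ' 0) j) a b w) c e := by
  unfold OddMoments.zerothMoment
  refine tsum_congr fun w => ?_
  simp only [OneStepKernelFamily.flipK_apply]
  exact record_unitBorder_universal hLc N N' tabs cΛ cΛ' j c e (-w)

/-- [folklore] **ONE NONVANISHING, ALL NUMERALS AND ALL `cΛ`**: if the universal unit-border zeroth moment of the table record is nonzero in some channel at level `j` (witnessed at ANY `N′`, `cΛ′`),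
then FOR EVERY numeral `N` and every `cΛ` at most ONE border weight admits the Ward binder at level `j`. -/
theorem record_borderWeight_unique_of_ward_universal (hLc : Odd Lc) (tabs : SymTables 3 Lc) (j : ℕ) {c e : Fin 4} (N' : ℕ) (cΛ' : ℝ)
    (hU : zerothMoment (fun a b w => flipK (TbalOf Lc (JsB12CombShSym hLc N' tabs cΛ' 1) j) a b w - flipK (TbalOf Lc (JsB12CombShSym hLc N' tabs cΛ' 0) j) a b w) c e ≠ 0)
    (N : ℕ) (cΛ cB cB' : ℝ) (hW : WardTransversal (flipK (TbalOf Lc (JsB12CombShSym hLc N tabs cΛ cB) j)))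
    (hW' : WardTransversal (flipK (TbalOf Lc (JsB12CombShSym hLc N tabs cΛ cB') j))) : cB = cB' := by
  rw [← record_unitBorder_zerothMoment_universal hLc N N' tabs cΛ cΛ' j c e] at hU
  by_contra hne
  exact hU (eq_zero_of_affine_pair (record_borderWeight_eq_of_ward hLc N tabs cΛ cB j hW c e) (record_borderWeight_eq_of_ward hLc N tabs cΛ cB' j hW' c e) hne).1

end Record

end Summit.QuantumFields.BalabanUV.Gaps.D1RecordUnitBorderUniversal

end
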